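import Mathlib.InformationTheory.Hamming
import Summits.MatrixMultiplication.MatrixMultiplication.Theses.CommutativeSchemes

/-!
# MatrixMultiplication / CommutativeSchemes — `HammingNoGo` (stmt-MatrixMultiplication-9468)

Route `CommutativeSchemes`, support item `HammingNoGo`: for `q ≥ 3` and every `D`, the Hamming
scheme `H(D,q)` realises no `⟨2,2,2⟩` — there are no `α β γ : Fin 2 × Fin 2 → ℕ` such that three
words `x y z : Fin D → Fin q` with pairwise Hamming distances `(α(a,b'), β(b,c'), γ(c,a'))` exist
iff `a = a' ∧ b = b' ∧ c = c'`.

Proof (the card's thick-top counting argument, specialised; injectivity of `α, β, γ` is not even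
needed). Write `R i j k` for "words at pairwise distances `(i,j,k)` exist". Two facts about `R`:

* (necessity) `R i j k → i ≤ D ∧ i ≤ j + k` (`hammingDist_le_card_fintype`, `hammingDist_triangle`);
* (sufficiency, `q ≥ 3`) if `j, k ≤ i ≤ j + k` and `i ≤ D` then `R i j k`: over the symbols
  `0, 1, 2` take `x = 0…0`, `y = 1^i 0^{D-i}`, `z = 0^{i-k} 2^{j-(i-k)} 1^{i-j} 0^{D-i}`.

`R` is invariant under cyclic rotation, and so is the realisation property (with `α, β, γ` rotated),
so we may assume a maximal entry among the twelve values sits at `M = α(i₀,j₀)`. Put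
`b_k = β(j₀,k)`, `c_k = γ(k,i₀)`; the realisation says `R M b_{k'} c_k ↔ k = k'`. The diagonal
instances give `M ≤ b₀ + c₀` and `M ≤ b₁ + c₁`; the off-diagonal non-instances give, by
sufficiency, `M > b₁ + c₀` and `M > b₀ + c₁`; summing is absurd.
-/

-- the tree's namespace `Summit.MatrixMultiplication.MatrixMultiplication.…` repeats a component
-- by design
set_option linter.dupNamespace false

namespace Summit.MatrixMultiplication.MatrixMultiplication.Theorems

open Summit.MatrixMultiplication.MatrixMultiplication.Theses.CommutativeSchemes

/-- Cardinality of an interval of indices of `Fin D`: if `p i ↔ lo ≤ i < hi` pointwise and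
`hi ≤ D`, then `#{i : Fin D | p i} = hi - lo`. -/
theorem hammingNoGo_card_filter_eq (D : ℕ) (p : Fin D → Prop) [DecidablePred p] (lo hi : ℕ)
    (hhi : hi ≤ D) (hp : ∀ i : Fin D, p i ↔ lo ≤ (i : ℕ) ∧ (i : ℕ) < hi) :
    (Finset.univ.filter p).card = hi - lo := by
  apply Finset.card_eq_of_bijective (fun n (_ : n < hi - lo) => (⟨lo + n, by omega⟩ : Fin D))
  · intro a ha
    rw [Finset.mem_filter] at ha
    obtain ⟨h1, h2⟩ := (hp a).mp ha.2
    exact ⟨(a : ℕ) - lo, by omega, Fin.ext (by show lo + ((a : ℕ) - lo) = (a : ℕ); omega)⟩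
  · intro n hn
    rw [Finset.mem_filter]
    exact ⟨Finset.mem_univ _, (hp _).mpr ⟨Nat.le_add_right lo n, by show lo + n < hi; omega⟩⟩
  · intro m n _ _ h
    have := congrArg Fin.val h
    simp only at this
    omega

/-- Hamming distance of two words of `Fin D → Fin q` that differ exactly on the index interval
`[lo, hi)`, `hi ≤ D`: it is `hi - lo`. -/
theorem hammingNoGo_hammingDist_eq (D q : ℕ) (x y : Fin D → Fin q) (lo hi : ℕ) (hhi : hi ≤ D)
    (hp : ∀ i : Fin D, x i ≠ y i ↔ lo ≤ (i : ℕ) ∧ (i : ℕ) < hi) : hammingDist x y = hi - lo := by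
  unfold hammingDist
  exact hammingNoGo_card_filter_eq D _ lo hi hhi hp

/-- Sufficiency half of the triangle relation of `H(D,q)`, `q ≥ 3` (the part the no-go needs):
if `j, k ≤ i ≤ j + k` and `i ≤ D` then there are words `x y z : Fin D → Fin q` with
`d(x,y) = i`, `d(y,z) = j`, `d(z,x) = k` — namely `x = 0^D`, `y = 1^i 0^{D-i}`,
`z = 0^{i-k} 2^{j-(i-k)} 1^{i-j} 0^{D-i}`. -/
theorem hammingNoGo_triple_exists {D q : ℕ} (hq : 3 ≤ q) {i j k : ℕ} (hj : j ≤ i) (hk : k ≤ i)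
    (hijk : i ≤ j + k) (hiD : i ≤ D) :
    ∃ x y z : Fin D → Fin q,
      hammingDist x y = i ∧ hammingDist y z = j ∧ hammingDist z x = k := by
  refine ⟨fun _ => ⟨0, by omega⟩,
    fun n => if (n : ℕ) < i then ⟨1, by omega⟩ else ⟨0, by omega⟩,
    fun n => if (n : ℕ) < i - k then ⟨0, by omega⟩ else if (n : ℕ) < j then ⟨2, by omega⟩
      else if (n : ℕ) < i then ⟨1, by omega⟩ else ⟨0, by omega⟩, ?_, ?_, ?_⟩
  · refine (hammingNoGo_hammingDist_eq D q _ _ 0 i hiD fun n => ?_).trans (Nat.sub_zero i)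
    split_ifs <;>
      simp only [ne_eq, Fin.mk.injEq, not_true_eq_false, false_iff] <;>
      omega
  · refine (hammingNoGo_hammingDist_eq D q _ _ 0 j (hj.trans hiD) fun n => ?_).trans
      (Nat.sub_zero j)
    split_ifs <;>
      simp only [ne_eq, Fin.mk.injEq, not_true_eq_false, false_iff] <;>
      omega
  · refine (hammingNoGo_hammingDist_eq D q _ _ (i - k) i hiD fun n => ?_).trans (by omega)
    split_ifs <;>
      simp only [ne_eq, Fin.mk.injEq, not_true_eq_false, false_iff] <;>
      omega

/-- The thick-top counting step (the route's `ThickTopLemma` with one type, `n = 2`): for a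
relation `R` on distance triples with `R i j k → i ≤ D ∧ i ≤ j + k` and
`j, k ≤ i ≤ j + k, i ≤ D → R i j k`, no `α β γ : Fin 2 × Fin 2 → ℕ` realise `⟨2,2,2⟩` over `R`
with an entry `α(i₀,j₀)` dominating `β(j₀,·)` and `γ(·,i₀)`: the two diagonal triangles give
`α(i₀,j₀) ≤ β(j₀,k) + γ(k,i₀)` (`k = 0, 1`), the two off-diagonal non-triangles give
`α(i₀,j₀) > β(j₀,1) + γ(0,i₀)` and `α(i₀,j₀) > β(j₀,0) + γ(1,i₀)`; summing is absurd. -/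
theorem hammingNoGo_of_dominant {D : ℕ} (R : ℕ → ℕ → ℕ → Prop)
    (hR₁ : ∀ i j k, R i j k → i ≤ D ∧ i ≤ j + k)
    (hR₂ : ∀ i j k, j ≤ i → k ≤ i → i ≤ j + k → i ≤ D → R i j k)
    (α β γ : Fin 2 × Fin 2 → ℕ)
    (h : ∀ a a' b b' c c' : Fin 2,
      R (α (a, b')) (β (b, c')) (γ (c, a')) ↔ (a = a' ∧ b = b' ∧ c = c'))
    (i₀ j₀ : Fin 2) (hdom : ∀ k : Fin 2, β (j₀, k) ≤ α (i₀, j₀) ∧ γ (k, i₀) ≤ α (i₀, j₀)) :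
    False := by
  obtain ⟨hD, h00⟩ := hR₁ _ _ _ ((h i₀ i₀ j₀ j₀ 0 0).mpr ⟨rfl, rfl, rfl⟩)
  obtain ⟨-, h11⟩ := hR₁ _ _ _ ((h i₀ i₀ j₀ j₀ 1 1).mpr ⟨rfl, rfl, rfl⟩)
  have h01 : ¬ (α (i₀, j₀) ≤ β (j₀, 1) + γ (0, i₀)) := fun hle =>
    absurd ((h i₀ i₀ j₀ j₀ 0 1).mp (hR₂ _ _ _ (hdom 1).1 (hdom 0).2 hle hD)).2.2 (by decide)
  have h10 : ¬ (α (i₀, j₀) ≤ β (j₀, 0) + γ (1, i₀)) := fun hle =>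
    absurd ((h i₀ i₀ j₀ j₀ 1 0).mp (hR₂ _ _ _ (hdom 0).1 (hdom 1).2 hle hD)).2.2 (by decide)
  omega

/-- The abstract no-go: for a cyclically invariant relation `R` on distance triples with
`R i j k → i ≤ D ∧ i ≤ j + k` and `j, k ≤ i ≤ j + k, i ≤ D → R i j k`, no
`α β γ : Fin 2 × Fin 2 → ℕ` realise `⟨2,2,2⟩` over `R`. Reduction to `hammingNoGo_of_dominant`:
a maximal entry among the twelve values sits on `α`, `β` or `γ`, and rotating the realisation
cyclically puts it on the first map. -/
theorem hammingNoGo_abstract {D : ℕ} (R : ℕ → ℕ → ℕ → Prop)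
    (hR₁ : ∀ i j k, R i j k → i ≤ D ∧ i ≤ j + k)
    (hR₂ : ∀ i j k, j ≤ i → k ≤ i → i ≤ j + k → i ≤ D → R i j k)
    (hrot : ∀ i j k, R i j k ↔ R j k i)
    (α β γ : Fin 2 × Fin 2 → ℕ)
    (h : ∀ a a' b b' c c' : Fin 2,
      R (α (a, b')) (β (b, c')) (γ (c, a')) ↔ (a = a' ∧ b = b' ∧ c = c')) : False := by
  -- rotating a realisation
  have rot : ∀ α β γ : Fin 2 × Fin 2 → ℕ,
      (∀ a a' b b' c c' : Fin 2,
        R (α (a, b')) (β (b, c')) (γ (c, a')) ↔ (a = a' ∧ b = b' ∧ c = c')) →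
      (∀ a a' b b' c c' : Fin 2,
        R (β (a, b')) (γ (b, c')) (α (c, a')) ↔ (a = a' ∧ b = b' ∧ c = c')) := by
    intro α β γ h a a' b b' c c'
    rw [← hrot, h c c' a a' b b']
    tauto
  -- maximal entries of the three maps
  obtain ⟨⟨ia, ja⟩, -, ha⟩ := Finset.exists_max_image Finset.univ α Finset.univ_nonempty
  obtain ⟨⟨ib, jb⟩, -, hb⟩ := Finset.exists_max_image Finset.univ β Finset.univ_nonempty
  obtain ⟨⟨ic, jc⟩, -, hc⟩ := Finset.exists_max_image Finset.univ γ Finset.univ_nonempty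
  simp only [Finset.mem_univ, forall_true_left] at ha hb hc
  by_cases hA : β (ib, jb) ≤ α (ia, ja) ∧ γ (ic, jc) ≤ α (ia, ja)
  · exact hammingNoGo_of_dominant R hR₁ hR₂ α β γ h ia ja
      fun k => ⟨(hb _).trans hA.1, (hc _).trans hA.2⟩
  by_cases hB : γ (ic, jc) ≤ β (ib, jb)
  · have hαβ : α (ia, ja) ≤ β (ib, jb) := by omega
    exact hammingNoGo_of_dominant R hR₁ hR₂ β γ α (rot α β γ h) ib jb
      fun k => ⟨(hc _).trans hB, (ha _).trans hαβ⟩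
  · have hαγ : α (ia, ja) ≤ γ (ic, jc) := by omega
    have hβγ : β (ib, jb) ≤ γ (ic, jc) := by omega
    exact hammingNoGo_of_dominant R hR₁ hR₂ γ α β (rot β γ α (rot α β γ h)) ic jc
      fun k => ⟨(ha _).trans hαγ, (hb _).trans hβγ⟩

/-- **`HammingNoGo`** (route CommutativeSchemes, item stmt-MatrixMultiplication-9468): for `q ≥ 3`
and every `D`, the Hamming scheme `H(D,q)` realises no `⟨2,2,2⟩` in the sense of Cohn–Umans 2013
(Def. 11/12) — even without injectivity of `α, β, γ`. The Hamming triangle relation satisfies the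
hypotheses of `hammingNoGo_abstract`: necessity by `hammingDist_le_card_fintype` and
`hammingDist_triangle`, sufficiency by the explicit words of `hammingNoGo_triple_exists`, cyclic
invariance by rotating the three words. -/
theorem hammingNoGo_proof :
    Summit.MatrixMultiplication.MatrixMultiplication.Theses.CommutativeSchemes.HammingNoGo := by
  unfold HammingNoGo
  rintro D q hq ⟨α, β, γ, -, -, -, h⟩
  refine hammingNoGo_abstract (D := D)
    (fun i j k => ∃ x y z : Fin D → Fin q,
      hammingDist x y = i ∧ hammingDist y z = j ∧ hammingDist z x = k)
    ?_ (fun i j k hj hk hijk hiD => hammingNoGo_triple_exists hq hj hk hijk hiD) ?_ α β γ h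
  · rintro i j k ⟨x, y, z, rfl, rfl, rfl⟩
    refine ⟨?_, ?_⟩
    · simpa using hammingDist_le_card_fintype (x := x) (y := y)
    · calc hammingDist x y ≤ hammingDist x z + hammingDist z y := hammingDist_triangle x z y
        _ = hammingDist y z + hammingDist z x := by
          rw [hammingDist_comm z y, hammingDist_comm x z, add_comm]
  · intro i j k
    exact ⟨fun ⟨x, y, z, h1, h2, h3⟩ => ⟨y, z, x, h2, h3, h1⟩,
      fun ⟨x, y, z, h1, h2, h3⟩ => ⟨z, x, y, h3, h1, h2⟩⟩

end Summit.MatrixMultiplication.MatrixMultiplication.Theorems
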